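import Summits.Ventures.PercRepro.PuncturedLYMTwoCoHyp

/-!
# PercRepro — TWO CO-HYPERPLANES OF ANY INTERSECTION: THE REDUCTION OF (SP) TO FOUR SEQUENCES IN THREE INDICES
(p10, gen 35)

For `C₁ = A ∪ S`, `C₂ = B ∪ S` with `A, B, S` pairwise disjoint and `#A + #B + #S ≥ j + 2` (two nontrivial hyperplanes
`E ∖ C₁`, `E ∖ C₂` of a paving matroid, `S = E ∖ (H₁ ∪ H₂)`), the family `D = upLevel j C₁ ∪ upLevel j C₂` is the
co-code; no `(j+1)`-set contains both.  The SYMMETRIC weights are four sequences in the profile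
`(a, b, d) = (#(X ∩ A), #(X ∩ B), #(X ∩ S))`: the completion `X ↦ insert y X` has weight `wA a b d` for `y ∈ A`,
`wB a b d` for `y ∈ B`, `wD a b d` for `y ∈ S`, `wR a b d` otherwise (`hW3`, `hW3p`).
* `sum_sups_hW3` — the row sum at `X`: `(#A − a)·wA + (#B − b)·wB + (#S − d)·wD + (n − j − #A − #B − #S + a + b + d)·wR`;
* `sum_subsP_hW3_untouched` — the column sum at a `(j+1)`-set containing neither `C₁` nor `C₂`:
  `a'·wA (a'−1) b' d' + b'·wB a' (b'−1) d' + d'·wD a' b' (d'−1) + (j + 1 − a' − b' − d')·wR a' b' d'`;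
  `sum_subsP_hW3_top₁` / `top₂` — at a set containing `C₁` (resp. `C₂`): `#A·wA (#A−1) b' #S + #S·wD #A b' (#S−1)`
  (resp. `#B·wB a' (#B−1) #S + #S·wD a' #B (#S−1)`);
* the reduction to four sequences (`puncturedNMP_gen_of_seq`) is in PuncturedLYMTwoCoHypGenMain.
For `S = ∅` this is the gen-34 reduction (PuncturedLYMTwoCoHyp).  Nothing here asserts (SP), (PAV) or (NC).
-/

namespace PercRepro.PuncturedLYM

open Finset

variable {α : Type} [Fintype α] [DecidableEq α]

/-! ### The weights -/

/-- The weight of the completion `X ↦ insert y X`: `wA a b d` for `y ∈ A`, `wB a b d` for `y ∈ B`, `wD a b d` for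
`y ∈ S`, `wR a b d` otherwise, with `(a, b, d) = (#(X ∩ A), #(X ∩ B), #(X ∩ S))`. -/
def hW3 (wA wB wD wR : ℕ → ℕ → ℕ → ℚ) (A B S X : Finset α) (y : α) : ℚ :=
  if y ∈ A then wA (aOf A X) (aOf B X) (aOf S X)
  else if y ∈ B then wB (aOf A X) (aOf B X) (aOf S X)
  else if y ∈ S then wD (aOf A X) (aOf B X) (aOf S X)
  else wR (aOf A X) (aOf B X) (aOf S X)

/-- The weights on a pair `(X, Y)`: `hW3` at the point of `Y ∖ X`. -/
def hW3p (wA wB wD wR : ℕ → ℕ → ℕ → ℚ) (A B S X Y : Finset α) : ℚ :=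
  ∑ y ∈ Y \ X, hW3 wA wB wD wR A B S X y

omit [Fintype α] in
/-- `hW3p X (insert y X) = hW3 X y` for `y ∉ X`. -/
theorem hW3p_insert (wA wB wD wR : ℕ → ℕ → ℕ → ℚ) (A B S X : Finset α) {y : α} (hy : y ∉ X) :
    hW3p wA wB wD wR A B S X (insert y X) = hW3 wA wB wD wR A B S X y := by
  unfold hW3p
  have h : insert y X \ X = {y} := by
    ext z
    simp only [mem_sdiff, mem_insert, mem_singleton]
    constructor
    · rintro ⟨h1, h2⟩
      exact h1.resolve_right h2
    · rintro rfl
      exact ⟨Or.inl rfl, hy⟩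
  rw [h, sum_singleton]

/-! ### Row sums -/

/-- **The row sum at a `j`-set `X`** (`A, B, S` pairwise disjoint):
`(#A − a)·wA + (#B − b)·wB + (#S − d)·wD + (n − j − #A − #B − #S + a + b + d)·wR`. -/
theorem sum_sups_hW3 {j : ℕ} (wA wB wD wR : ℕ → ℕ → ℕ → ℚ) {A B S X : Finset α} (hAB : Disjoint A B)
    (hAS : Disjoint A S) (hBS : Disjoint B S) (hX : X.card = j) :
    ∑ Y ∈ sups j X, hW3p wA wB wD wR A B S X Y =
      ((A.card : ℚ) - aOf A X) * wA (aOf A X) (aOf B X) (aOf S X) +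
        ((B.card : ℚ) - aOf B X) * wB (aOf A X) (aOf B X) (aOf S X) +
        ((S.card : ℚ) - aOf S X) * wD (aOf A X) (aOf B X) (aOf S X) +
        ((Fintype.card α : ℚ) - j - A.card - B.card - S.card + aOf A X + aOf B X + aOf S X) *
          wR (aOf A X) (aOf B X) (aOf S X) := by
  rw [sum_sups hX]
  have h1 : ∀ y ∈ univ \ X, hW3p wA wB wD wR A B S X (insert y X) = hW3 wA wB wD wR A B S X y :=
    fun y hy => hW3p_insert wA wB wD wR A B S X (mem_sdiff.1 hy).2
  rw [sum_congr rfl h1]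
  unfold hW3
  rw [sum_ite, sum_ite, sum_ite, sum_const, sum_const, sum_const, sum_const, nsmul_eq_mul, nsmul_eq_mul,
    nsmul_eq_mul, nsmul_eq_mul]
  have hA : (univ \ X).filter (fun y => y ∈ A) = A \ X := by
    ext y
    simp only [mem_filter, mem_sdiff, mem_univ, true_and]
    tauto
  have hB : ((univ \ X).filter (fun y => ¬ y ∈ A)).filter (fun y => y ∈ B) = B \ X := by
    ext y
    simp only [mem_filter, mem_sdiff, mem_univ, true_and]
    constructor
    · rintro ⟨⟨hyX, -⟩, hyB⟩
      exact ⟨hyB, hyX⟩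
    · rintro ⟨hyB, hyX⟩
      exact ⟨⟨hyX, fun h => disjoint_left.1 hAB h hyB⟩, hyB⟩
  have hS : (((univ \ X).filter (fun y => ¬ y ∈ A)).filter (fun y => ¬ y ∈ B)).filter (fun y => y ∈ S) = S \ X := by
    ext y
    simp only [mem_filter, mem_sdiff, mem_univ, true_and]
    constructor
    · rintro ⟨⟨⟨hyX, -⟩, -⟩, hyS⟩
      exact ⟨hyS, hyX⟩
    · rintro ⟨hyS, hyX⟩
      exact ⟨⟨⟨hyX, fun h => disjoint_left.1 hAS h hyS⟩, fun h => disjoint_left.1 hBS h hyS⟩, hyS⟩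
  have hR : (((univ \ X).filter (fun y => ¬ y ∈ A)).filter (fun y => ¬ y ∈ B)).filter (fun y => ¬ y ∈ S) =
      univ \ (X ∪ A ∪ B ∪ S) := by
    ext y
    simp only [mem_filter, mem_sdiff, mem_univ, true_and, mem_union, not_or]
  rw [hA, hB, hS, hR, card_univ_sdiff]
  have hcA := card_sdiff_B (X := X) (B := A) rfl
  have hcB := card_sdiff_B (X := X) (B := B) rfl
  have hcS := card_sdiff_B (X := X) (B := S) rfl
  have ha : aOf A X ≤ A.card := by omega
  have hb : aOf B X ≤ B.card := by omega
  have hd : aOf S X ≤ S.card := by omega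
  have hu : (X ∪ A ∪ B ∪ S).card = j + (A.card - aOf A X) + (B.card - aOf B X) + (S.card - aOf S X) := by
    have e : X ∪ A ∪ B ∪ S = X ∪ ((A \ X) ∪ ((B \ X) ∪ (S \ X))) := by
      ext y
      simp only [mem_union, mem_sdiff]
      tauto
    have dBS : Disjoint (B \ X) (S \ X) := hBS.mono sdiff_subset sdiff_subset
    have dA : Disjoint (A \ X) ((B \ X) ∪ (S \ X)) :=
      disjoint_union_right.2 ⟨hAB.mono sdiff_subset sdiff_subset, hAS.mono sdiff_subset sdiff_subset⟩
    have dX : Disjoint X ((A \ X) ∪ ((B \ X) ∪ (S \ X))) :=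
      disjoint_union_right.2 ⟨disjoint_sdiff, disjoint_union_right.2 ⟨disjoint_sdiff, disjoint_sdiff⟩⟩
    rw [e, card_union_of_disjoint dX, card_union_of_disjoint dA, card_union_of_disjoint dBS, hX]
    omega
  have hXC : (X ∪ A ∪ B ∪ S).card ≤ Fintype.card α := card_le_univ _
  have e1 : ((A \ X).card : ℚ) = A.card - aOf A X := by
    have : (A \ X).card = A.card - aOf A X := by omega
    rw [this, Nat.cast_sub ha]
  have e2 : ((B \ X).card : ℚ) = B.card - aOf B X := by
    have : (B \ X).card = B.card - aOf B X := by omega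
    rw [this, Nat.cast_sub hb]
  have e3 : ((S \ X).card : ℚ) = S.card - aOf S X := by
    have : (S \ X).card = S.card - aOf S X := by omega
    rw [this, Nat.cast_sub hd]
  have e4 : ((Fintype.card α - (X ∪ A ∪ B ∪ S).card : ℕ) : ℚ) =
      (Fintype.card α : ℚ) - j - A.card - B.card - S.card + aOf A X + aOf B X + aOf S X := by
    rw [Nat.cast_sub hXC, hu, Nat.cast_add, Nat.cast_add, Nat.cast_add, Nat.cast_sub ha, Nat.cast_sub hb,
      Nat.cast_sub hd]
    ring
  rw [e1, e2, e3, e4]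
  ring

/-! ### Column sums -/

/-- **The column sum at a `(j+1)`-set `Y` containing neither `C₁ = A ∪ S` nor `C₂ = B ∪ S`** (`A, B, S` pairwise
disjoint), with `a' = #(Y ∩ A)`, `b' = #(Y ∩ B)`, `d' = #(Y ∩ S)`:
`a'·wA (a'−1) b' d' + b'·wB a' (b'−1) d' + d'·wD a' b' (d'−1) + (j + 1 − a' − b' − d')·wR a' b' d'`. -/
theorem sum_subsP_hW3_untouched {j : ℕ} (wA wB wD wR : ℕ → ℕ → ℕ → ℚ) {A B S Y : Finset α} (hAB : Disjoint A B)
    (hAS : Disjoint A S) (hBS : Disjoint B S) (hY : Y.card = j + 1) (h1 : ¬ A ∪ S ⊆ Y) (h2 : ¬ B ∪ S ⊆ Y) :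
    ∑ X ∈ subsP j (upLevel j (A ∪ S) ∪ upLevel j (B ∪ S)) Y, hW3p wA wB wD wR A B S X Y =
      ((Y ∩ A).card : ℚ) * wA ((Y ∩ A).card - 1) (Y ∩ B).card (Y ∩ S).card +
        ((Y ∩ B).card : ℚ) * wB (Y ∩ A).card ((Y ∩ B).card - 1) (Y ∩ S).card +
        ((Y ∩ S).card : ℚ) * wD (Y ∩ A).card (Y ∩ B).card ((Y ∩ S).card - 1) +
        ((j : ℚ) + 1 - (Y ∩ A).card - (Y ∩ B).card - (Y ∩ S).card) * wR (Y ∩ A).card (Y ∩ B).card (Y ∩ S).card := by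
  rw [subsP_union_upLevel_eq_image_erase hY h1 h2, sum_image (erase_injOn Y)]
  have hterm : ∀ z ∈ Y, hW3p wA wB wD wR A B S (Y.erase z) Y =
      if z ∈ A then wA ((Y ∩ A).card - 1) (Y ∩ B).card (Y ∩ S).card
      else if z ∈ B then wB (Y ∩ A).card ((Y ∩ B).card - 1) (Y ∩ S).card
      else if z ∈ S then wD (Y ∩ A).card (Y ∩ B).card ((Y ∩ S).card - 1)
      else wR (Y ∩ A).card (Y ∩ B).card (Y ∩ S).card := by
    intro z hz
    unfold hW3p
    rw [sdiff_erase_eq_singleton hz, sum_singleton]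
    unfold hW3
    have hkA := aOf_erase A hz
    have hkB := aOf_erase B hz
    have hkS := aOf_erase S hz
    split_ifs with hzA hzB hzS
    · have hzB : z ∉ B := fun h => disjoint_left.1 hAB hzA h
      have hzS : z ∉ S := fun h => disjoint_left.1 hAS hzA h
      rw [if_pos hzA] at hkA
      rw [if_neg hzB, add_zero] at hkB
      rw [if_neg hzS, add_zero] at hkS
      have : aOf A (Y.erase z) = (Y ∩ A).card - 1 := by omega
      rw [this, hkB, hkS]
    · have hzS : z ∉ S := fun h => disjoint_left.1 hBS hzB h
      rw [if_neg hzA, add_zero] at hkA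
      rw [if_pos hzB] at hkB
      rw [if_neg hzS, add_zero] at hkS
      have : aOf B (Y.erase z) = (Y ∩ B).card - 1 := by omega
      rw [this, hkA, hkS]
    · rw [if_neg hzA, add_zero] at hkA
      rw [if_neg hzB, add_zero] at hkB
      rw [if_pos hzS] at hkS
      have : aOf S (Y.erase z) = (Y ∩ S).card - 1 := by omega
      rw [this, hkA, hkB]
    · rw [if_neg hzA, add_zero] at hkA
      rw [if_neg hzB, add_zero] at hkB
      rw [if_neg hzS, add_zero] at hkS
      rw [hkA, hkB, hkS]
  rw [sum_congr rfl hterm, sum_ite, sum_ite, sum_ite, sum_const, sum_const, sum_const, sum_const, nsmul_eq_mul,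
    nsmul_eq_mul, nsmul_eq_mul, nsmul_eq_mul]
  have hkA : (Y.filter (fun z => z ∈ A)).card = (Y ∩ A).card := by rw [filter_mem_eq_inter]
  have hkB : ((Y.filter (fun z => ¬ z ∈ A)).filter (fun z => z ∈ B)).card = (Y ∩ B).card := by
    have e : (Y.filter (fun z => ¬ z ∈ A)).filter (fun z => z ∈ B) = Y ∩ B := by
      ext z
      simp only [mem_filter, mem_inter]
      constructor
      · rintro ⟨⟨hzY, -⟩, hzB⟩
        exact ⟨hzY, hzB⟩
      · rintro ⟨hzY, hzB⟩
        exact ⟨⟨hzY, fun h => disjoint_left.1 hAB h hzB⟩, hzB⟩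
    rw [e]
  have hkS : (((Y.filter (fun z => ¬ z ∈ A)).filter (fun z => ¬ z ∈ B)).filter (fun z => z ∈ S)).card =
      (Y ∩ S).card := by
    have e : ((Y.filter (fun z => ¬ z ∈ A)).filter (fun z => ¬ z ∈ B)).filter (fun z => z ∈ S) = Y ∩ S := by
      ext z
      simp only [mem_filter, mem_inter]
      constructor
      · rintro ⟨⟨⟨hzY, -⟩, -⟩, hzS⟩
        exact ⟨hzY, hzS⟩
      · rintro ⟨hzY, hzS⟩
        exact ⟨⟨⟨hzY, fun h => disjoint_left.1 hAS h hzS⟩, fun h => disjoint_left.1 hBS h hzS⟩, hzS⟩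
    rw [e]
  have hkR : (((Y.filter (fun z => ¬ z ∈ A)).filter (fun z => ¬ z ∈ B)).filter (fun z => ¬ z ∈ S)).card =
      j + 1 - (Y ∩ A).card - (Y ∩ B).card - (Y ∩ S).card := by
    have h1' := card_filter_add_card_filter_not (fun z => z ∈ A) (s := Y)
    have h2' := card_filter_add_card_filter_not (fun z => z ∈ B) (s := Y.filter (fun z => ¬ z ∈ A))
    have h3' := card_filter_add_card_filter_not (fun z => z ∈ S)
      (s := (Y.filter (fun z => ¬ z ∈ A)).filter (fun z => ¬ z ∈ B))
    rw [hY] at h1'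
    rw [hkA] at h1'
    rw [hkB] at h2'
    rw [hkS] at h3'
    omega
  have hYA : (Y ∩ A).card ≤ j + 1 := hY ▸ card_le_card inter_subset_left
  have hYAB : (Y ∩ A).card + (Y ∩ B).card ≤ j + 1 := by
    have e : (Y ∩ A) ∪ (Y ∩ B) = Y ∩ (A ∪ B) := (inter_union_distrib_left Y A B).symm
    have d : Disjoint (Y ∩ A) (Y ∩ B) := hAB.mono inter_subset_right inter_subset_right
    have := card_union_of_disjoint d
    rw [e] at this
    have := card_le_card (inter_subset_left (s₁ := Y) (s₂ := A ∪ B))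
    omega
  have hYABS : (Y ∩ A).card + (Y ∩ B).card + (Y ∩ S).card ≤ j + 1 := by
    have e : (Y ∩ A) ∪ (Y ∩ B) ∪ (Y ∩ S) = Y ∩ (A ∪ B ∪ S) := by
      rw [← inter_union_distrib_left, ← inter_union_distrib_left]
    have dAB : Disjoint (Y ∩ A) (Y ∩ B) := hAB.mono inter_subset_right inter_subset_right
    have dS : Disjoint ((Y ∩ A) ∪ (Y ∩ B)) (Y ∩ S) :=
      disjoint_union_left.2 ⟨hAS.mono inter_subset_right inter_subset_right,
        hBS.mono inter_subset_right inter_subset_right⟩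
    have h := card_union_of_disjoint dS
    rw [card_union_of_disjoint dAB, e] at h
    have := card_le_card (inter_subset_left (s₁ := Y) (s₂ := A ∪ B ∪ S))
    omega
  rw [hkA, hkB, hkS, hkR, Nat.cast_sub (by omega), Nat.cast_sub (by omega), Nat.cast_sub hYA]
  push_cast
  ring

/-- **The column sum at a `(j+1)`-set `Y ⊇ C₁ = A ∪ S` not containing `C₂ = B ∪ S`** (`A, B, S` pairwise disjoint):
`#A·wA (#A − 1) b' #S + #S·wD #A b' (#S − 1)`, `b' = #(Y ∩ B)`. -/
theorem sum_subsP_hW3_top₁ {j : ℕ} (wA wB wD wR : ℕ → ℕ → ℕ → ℚ) {A B S Y : Finset α} (hAB : Disjoint A B)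
    (hAS : Disjoint A S) (hBS : Disjoint B S) (hY : Y.card = j + 1) (h1 : A ∪ S ⊆ Y) (h2 : ¬ B ∪ S ⊆ Y) :
    ∑ X ∈ subsP j (upLevel j (A ∪ S) ∪ upLevel j (B ∪ S)) Y, hW3p wA wB wD wR A B S X Y =
      (A.card : ℚ) * wA (A.card - 1) (Y ∩ B).card S.card + (S.card : ℚ) * wD A.card (Y ∩ B).card (S.card - 1) := by
  rw [subsP_union_upLevel_eq_image_erase_top hY h1 h2, sum_image ((erase_injOn Y).mono (coe_subset.2 h1))]
  have hYA : Y ∩ A = A := inter_eq_right.2 (subset_union_left.trans h1)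
  have hYS : Y ∩ S = S := inter_eq_right.2 (subset_union_right.trans h1)
  have hterm : ∀ z ∈ A ∪ S, hW3p wA wB wD wR A B S (Y.erase z) Y =
      if z ∈ A then wA (A.card - 1) (Y ∩ B).card S.card else wD A.card (Y ∩ B).card (S.card - 1) := by
    intro z hz
    have hzY : z ∈ Y := h1 hz
    unfold hW3p
    rw [sdiff_erase_eq_singleton hzY, sum_singleton]
    unfold hW3
    have hkA := aOf_erase A hzY
    have hkB := aOf_erase B hzY
    have hkS := aOf_erase S hzY
    rw [hYA] at hkA
    rw [hYS] at hkS
    rcases mem_union.1 hz with hzA | hzS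
    · have hzB : z ∉ B := fun h => disjoint_left.1 hAB hzA h
      have hzS : z ∉ S := fun h => disjoint_left.1 hAS hzA h
      rw [if_pos hzA, if_pos hzA]
      rw [if_pos hzA] at hkA
      rw [if_neg hzB, add_zero] at hkB
      rw [if_neg hzS, add_zero] at hkS
      have : aOf A (Y.erase z) = A.card - 1 := by omega
      rw [this, hkB, hkS]
    · have hzA : z ∉ A := fun h => disjoint_left.1 hAS h hzS
      have hzB : z ∉ B := fun h => disjoint_left.1 hBS h hzS
      rw [if_neg hzA, if_neg hzA, if_neg hzB, if_pos hzS]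
      rw [if_neg hzA, add_zero] at hkA
      rw [if_neg hzB, add_zero] at hkB
      rw [if_pos hzS] at hkS
      have : aOf S (Y.erase z) = S.card - 1 := by omega
      rw [this, hkA, hkB]
  rw [sum_congr rfl hterm, sum_ite, sum_const, sum_const, nsmul_eq_mul, nsmul_eq_mul]
  have eA : (A ∪ S).filter (fun z => z ∈ A) = A := by
    ext z
    simp only [mem_filter, mem_union]
    tauto
  have eS : (A ∪ S).filter (fun z => ¬ z ∈ A) = S := by
    ext z
    simp only [mem_filter, mem_union]
    constructor
    · rintro ⟨h | h, hzA⟩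
      · exact absurd h hzA
      · exact h
    · intro hzS
      exact ⟨Or.inr hzS, fun h => disjoint_left.1 hAS h hzS⟩
  rw [eA, eS]

/-- **The column sum at a `(j+1)`-set `Y ⊇ C₂ = B ∪ S` not containing `C₁ = A ∪ S`**:
`#B·wB a' (#B − 1) #S + #S·wD a' #B (#S − 1)`, `a' = #(Y ∩ A)`. -/
theorem sum_subsP_hW3_top₂ {j : ℕ} (wA wB wD wR : ℕ → ℕ → ℕ → ℚ) {A B S Y : Finset α} (hAB : Disjoint A B)
    (hAS : Disjoint A S) (hBS : Disjoint B S) (hY : Y.card = j + 1) (h1 : ¬ A ∪ S ⊆ Y) (h2 : B ∪ S ⊆ Y) :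
    ∑ X ∈ subsP j (upLevel j (A ∪ S) ∪ upLevel j (B ∪ S)) Y, hW3p wA wB wD wR A B S X Y =
      (B.card : ℚ) * wB (Y ∩ A).card (B.card - 1) S.card + (S.card : ℚ) * wD (Y ∩ A).card B.card (S.card - 1) := by
  have hsub : subsP j (upLevel j (A ∪ S) ∪ upLevel j (B ∪ S)) Y = (B ∪ S).image (fun z => Y.erase z) := by
    rw [union_comm]
    exact subsP_union_upLevel_eq_image_erase_top hY h2 h1
  rw [hsub, sum_image ((erase_injOn Y).mono (coe_subset.2 h2))]
  have hYB : Y ∩ B = B := inter_eq_right.2 (subset_union_left.trans h2)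
  have hYS : Y ∩ S = S := inter_eq_right.2 (subset_union_right.trans h2)
  have hterm : ∀ z ∈ B ∪ S, hW3p wA wB wD wR A B S (Y.erase z) Y =
      if z ∈ B then wB (Y ∩ A).card (B.card - 1) S.card else wD (Y ∩ A).card B.card (S.card - 1) := by
    intro z hz
    have hzY : z ∈ Y := h2 hz
    unfold hW3p
    rw [sdiff_erase_eq_singleton hzY, sum_singleton]
    unfold hW3
    have hkA := aOf_erase A hzY
    have hkB := aOf_erase B hzY
    have hkS := aOf_erase S hzY
    rw [hYB] at hkB
    rw [hYS] at hkS
    rcases mem_union.1 hz with hzB | hzS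
    · have hzA : z ∉ A := fun h => disjoint_left.1 hAB h hzB
      have hzS : z ∉ S := fun h => disjoint_left.1 hBS hzB h
      rw [if_pos hzB, if_neg hzA, if_pos hzB]
      rw [if_neg hzA, add_zero] at hkA
      rw [if_pos hzB] at hkB
      rw [if_neg hzS, add_zero] at hkS
      have : aOf B (Y.erase z) = B.card - 1 := by omega
      rw [this, hkA, hkS]
    · have hzA : z ∉ A := fun h => disjoint_left.1 hAS h hzS
      have hzB : z ∉ B := fun h => disjoint_left.1 hBS h hzS
      rw [if_neg hzB, if_neg hzA, if_neg hzB, if_pos hzS]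
      rw [if_neg hzA, add_zero] at hkA
      rw [if_neg hzB, add_zero] at hkB
      rw [if_pos hzS] at hkS
      have : aOf S (Y.erase z) = S.card - 1 := by omega
      rw [this, hkA, hkB]
  rw [sum_congr rfl hterm, sum_ite, sum_const, sum_const, nsmul_eq_mul, nsmul_eq_mul]
  have eB : (B ∪ S).filter (fun z => z ∈ B) = B := by
    ext z
    simp only [mem_filter, mem_union]
    tauto
  have eS : (B ∪ S).filter (fun z => ¬ z ∈ B) = S := by
    ext z
    simp only [mem_filter, mem_union]
    constructor
    · rintro ⟨h | h, hzB⟩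
      · exact absurd h hzB
      · exact h
    · intro hzS
      exact ⟨Or.inr hzS, fun h => disjoint_left.1 hBS h hzS⟩
  rw [eB, eS]

end PercRepro.PuncturedLYM
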